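import Mathlib
import Literature.NumberTheory.Irrationality.BrownZudilin2022.GeneralFamily
import Summits.KontsevichZagierPeriods.Zeta5Search.JintegralMellinT
import Summits.KontsevichZagierPeriods.Zeta5Search.RhinViolaConjugation
import Summits.KontsevichZagierPeriods.Zeta5Search.CellularCubicalSubstitution
import Summits.KontsevichZagierPeriods.Zeta5Search.BarnesSymmetry
import HarnessLib

/-!
# ζ(5) search — Brown–Zudilin's generator `h'` WITHOUT Bailey's transformation: `J(p;q)·(p₂+q₂−p₁)!·p₆! = p₂!·q₃!·J(h'(p;q))` and (27) for `h'` (cell `pub-zeta5`, seat ct-1 g13)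

HONEST FRAMING: systematic search; no irrationality claim unless kernel-certified. Nothing in this file is an
irrationality result, a worthiness exponent or a denominator statement. Brown–Zudilin [BrownZudilin2022, Sect. 7, p. 17–18]
obtain the involution `h' : (p;q) ↦ (p₀, q₂, p₂+q₂−p₁, q₁+q₂, p₄−p₆+q₃, p₅−p₆+q₃, q₃; q₁, p₁, p₆, q₄, q₅)` keeping
`J(p;q)/(p₂!q₃!)` invariant from Bailey's `₇F₆` transformation (25) applied twice to the `s`-integral of (16). Here the same
identity is a KERNEL THEOREM by the Rhin–Viola route of memo `ct-1/g12/EULERSYM.md` §5: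
STEP 0 (`JintegralMellinT.Jintegral_mellin_T`: only the `p₆`-link opened) ∘ the word `φϑφσφχ` on the closed `(y₁,y₂,y₃)`-block with
complex `z`-exponents (`RhinViolaConjugation.rv_conj_hprime`: `h'` is the conjugate `σϑϑσ·φ·ϑϑ` of ONE Euler step, so
no condition on `p₀` arises) ∘ STEP 7 (re-coupling: `Γ(p₆+1+t)Γ(−t)·Γ(r−t)/Γ(−t)` is the
Mellin–Barnes weight of `h'(p;q)` at `t−r`, `r = q₃−p₆`; no residues, the contour is relabelled).

* `Jintegral_hprime` — `(p₂+q₂−p₁)!·p₆!·J(p;q) = p₂!·q₃!·J(p';q')` for integer `(p;q)` with (18b) `p₃+q₃ = p₆+q₁+q₂`, (19) `p₃ = p₁+q₁`,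
  `q ≥ 0`, `p₁,p₂,p₆ ≥ 0`, ANY `p₀ ∈ ℤ`, `p₁ ≤ p₂+q₂` and a common admissible abscissa;
* **`normalisedIntegral'_genH'`** — the `h'`-conjunct of the named Literature fact `invariance_of_converges'` (BZ22 (27)) for EVERY
  `a` with `a` and `h'a` convergent, no further hypothesis: the abscissa exists by the convergence forms (3) of `a` and `h'a` alone.

Theorems only (no new definitions); no status word, no `γ`, nothing about ζ(5).
-/

noncomputable section

namespace Summit.KontsevichZagierPeriods.Zeta5Search.JintegralHprime

open MeasureTheory Set Filter
open scoped Real Nat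
open Literature.NumberTheory.Irrationality.BrownZudilin2022
open Summit.KontsevichZagierPeriods.Zeta5Search.JintegralMellinT (Jintegral_mellin_T)
open Summit.KontsevichZagierPeriods.Zeta5Search.RhinViolaConjugation (rv_conj_hprime)
open Summit.KontsevichZagierPeriods.Zeta5Search.BarnesSymmetry (normF_pos)
open Summit.KontsevichZagierPeriods.Zeta5Search.CellularCubicalSubstitution (cellularIntegral_eq_Jintegral)

/-! ### 1. `J(p;q)·(p₂+q₂−p₁)!·p₆! = p₂!·q₃!·J(p';q')` -/

/-- **Brown–Zudilin's `h'` for `J(p;q)`, Bailey-free.** Let `(p;q)`, `(p';q')` be integer parameters with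
`p' = (p₀, q₂, p₂+q₂−p₁, q₁+q₂, p₄+q₃−p₆, p₅+q₃−p₆, q₃)`, `q' = (q₁, p₁, p₆, q₄, q₅)` (printed indices), (18b) `p₃+q₃ = p₆+q₁+q₂`,
(19) `p₃ = p₁+q₁`, naturals `p₁ = k₁ ≤ p₂+q₂`, `q₁ = l₁`, `p₂ = k₂`, `q₂ = l₂`, `p₆ = m₆`, `q₃ = n`, `q₄, q₅ ≥ 0`, and
abscissae `c₂`, `c₂' = c₂ + q₃ − p₆` with `max(0, p₆−q₃, p₀−q₂, p₀+p₁−p₂−q₂) < c₂ < min(p₄+1, p₅+1, p₆+1, p₃+2)` (`p₀ ∈ ℤ` free). Then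
`(p₂+q₂−p₁)!·p₆!·J(p;q) = p₂!·q₃!·J(p';q')`. [BrownZudilin2022, Sect. 7, p. 17–18 (`h'`); RV §4] -/
theorem Jintegral_hprime (p p' : Fin 7 → ℤ) (q q' : Fin 5 → ℤ) {k1 l1 k2 l2 m₆ n : ℕ} (hk1 : p 1 = k1) (hl1 : q 0 = l1) (hk2 : p 2 = k2) (hl2 : q 1 = l2) (hm : p 6 = m₆) (hn : q 2 = n)
    (hq3 : 0 ≤ q 3) (hq4 : 0 ≤ q 4) (h18 : p 3 + q 2 = p 6 + q 0 + q 1) (h19 : p 3 = p 1 + q 0)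
    (hk : k1 ≤ k2 + l2)
    (e0 : p' 0 = p 0) (e1 : p' 1 = q 1) (e2 : p' 2 = p 2 + q 1 - p 1) (e3 : p' 3 = q 0 + q 1) (e4 : p' 4 + p 6 = p 4 + q 2)
    (e5 : p' 5 + p 6 = p 5 + q 2) (e6 : p' 6 = q 2) (f0 : q' 0 = q 0) (f1 : q' 1 = p 1) (f2 : q' 2 = p 6) (f3 : q' 3 = q 3)
    (f4 : q' 4 = q 4) {c₂ c₂' : ℝ} (hc' : c₂' + m₆ = c₂ + n) (hc0 : 0 < c₂) (hc0' : 0 < c₂') (hc6 : c₂ < (m₆ : ℝ) + 1)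
    (hc4 : c₂ < (p 4 : ℝ) + 1) (hc5 : c₂ < (p 5 : ℝ) + 1) (hc3 : c₂ < (p 3 : ℝ) + 2) (hcA : (p 0 : ℝ) - l2 < c₂)
    (hcB : (p 0 : ℝ) + k1 - k2 - l2 < c₂) :
    (((k2 + l2 - k1)! * m₆ ! : ℕ) : ℝ) * Jintegral p q = ((k2 ! * n ! : ℕ) : ℝ) * Jintegral p' q' := by
  -- integer / real / complex bookkeeping of the hypotheses
  have h18R : (p 3 : ℝ) + q 2 = p 6 + q 0 + q 1 := by exact_mod_cast h18
  have h19R : (p 3 : ℝ) = p 1 + q 0 := by exact_mod_cast h19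
  have hk1R : (p 1 : ℝ) = k1 := by rw [hk1]; rfl
  have hl1R : (q 0 : ℝ) = l1 := by rw [hl1]; rfl
  have hk2R : (p 2 : ℝ) = k2 := by rw [hk2]; rfl
  have hl2R : (q 1 : ℝ) = l2 := by rw [hl2]; rfl
  have hmR : (p 6 : ℝ) = m₆ := by rw [hm]; rfl
  have hnR : (q 2 : ℝ) = n := by rw [hn]; rfl
  have e4R : (p' 4 : ℝ) + p 6 = p 4 + q 2 := by exact_mod_cast e4
  have e5R : (p' 5 : ℝ) + p 6 = p 5 + q 2 := by exact_mod_cast e5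
  have e2R : (p' 2 : ℝ) = p 2 + q 1 - p 1 := by exact_mod_cast e2
  have e3R : (p' 3 : ℝ) = q 0 + q 1 := by exact_mod_cast e3
  have hkR : (k1 : ℝ) ≤ k2 + l2 := by exact_mod_cast hk
  -- STEP 0 for `(p;q)` at `c₂` and for `(p';q')` at `c₂'`
  have hq : ∀ j, 0 ≤ q j := by
    intro j; fin_cases j
    · simp [hl1]
    · simp [hl2]
    · simp [hn]
    · exact hq3
    · exact hq4
  have hq' : ∀ j, 0 ≤ q' j := by
    intro j; fin_cases j
    · simp [f0, hl1]
    · simp [f1, hk1]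
    · simp [f2, hm]
    · simp [f3]; exact hq3
    · simp [f4]; exact hq4
  have hJ := Jintegral_mellin_T p q hq hm (by rw [hk1]; positivity) (by rw [hk2]; positivity) hc0 hc6 hc4 hc5 hc3
    (by rw [hnR]; linarith) (by rw [hk1R, hnR]; linarith) (by rw [hk2R, hnR]; linarith)
  have hJ' := Jintegral_mellin_T p' q' hq' (m₆ := n) (by rw [e6, hn]) (by rw [e1, hl2]; positivity)
    (by rw [e2, hk2, hl2, hk1]; omega) (c₂ := c₂') hc0' (by linarith) (by linarith) (by linarith)
    (by rw [e3R]; linarith) (by rw [f2, hmR]; linarith) (by rw [e0, e1, f2, hl2R, hmR]; linarith)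
    (by rw [e0, f2, e2R, hk2R, hl2R, hk1R, hmR]; linarith)
  -- complex-cast versions
  have hc'C : (c₂' : ℂ) + (m₆ : ℂ) = (c₂ : ℂ) + (n : ℂ) := by exact_mod_cast hc'
  have h18C : ((p 3 : ℤ) : ℂ) + (n : ℂ) = (m₆ : ℂ) + (l1 : ℂ) + (l2 : ℂ) := by
    have := h18; rw [hn, hm, hl1, hl2] at this; exact_mod_cast this
  have h19C : ((p 3 : ℤ) : ℂ) = (k1 : ℂ) + (l1 : ℂ) := by
    have := h19; rw [hk1, hl1] at this; exact_mod_cast this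
  have e4C : ((p' 4 : ℤ) : ℂ) + (m₆ : ℂ) = ((p 4 : ℤ) : ℂ) + (n : ℂ) := by
    have := e4; rw [hm, hn] at this; exact_mod_cast this
  have e5C : ((p' 5 : ℤ) : ℂ) + (m₆ : ℂ) = ((p 5 : ℤ) : ℂ) + (n : ℂ) := by
    have := e5; rw [hm, hn] at this; exact_mod_cast this
  have e2C : ((p' 2 : ℤ) : ℂ) = (k2 : ℂ) + (l2 : ℂ) - (k1 : ℂ) := by
    have := e2; rw [hk2, hl2, hk1] at this; exact_mod_cast this
  have e3C : ((p' 3 : ℤ) : ℂ) = (l1 : ℂ) + (l2 : ℂ) := by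
    have := e3; rw [hl1, hl2] at this; exact_mod_cast this
  have a1 : ((p 1 : ℤ) : ℂ) = (k1 : ℂ) := by rw [hk1]; rfl
  have a2 : ((q 0 : ℤ) : ℂ) = (l1 : ℂ) := by rw [hl1]; rfl
  have a3 : ((p 2 : ℤ) : ℂ) = (k2 : ℂ) := by rw [hk2]; rfl
  have a4 : ((q 1 : ℤ) : ℂ) = (l2 : ℂ) := by rw [hl2]; rfl
  have a5 : ((q 2 : ℤ) : ℂ) = (n : ℂ) := by rw [hn]; rfl
  have b0 : ((p' 0 : ℤ) : ℂ) = ((p 0 : ℤ) : ℂ) := by rw [e0]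
  have b1 : ((p' 1 : ℤ) : ℂ) = (l2 : ℂ) := by rw [e1, hl2]; rfl
  have b2 : ((q' 0 : ℤ) : ℂ) = (l1 : ℂ) := by rw [f0, hl1]; rfl
  have b3 : ((q' 1 : ℤ) : ℂ) = (k1 : ℂ) := by rw [f1, hk1]; rfl
  have b4 : ((q' 2 : ℤ) : ℂ) = (m₆ : ℂ) := by rw [f2, hm]; rfl
  have b5 : ((q' 3 : ℤ) : ℂ) = ((q 3 : ℤ) : ℂ) := by rw [f3]
  have b6 : ((q' 4 : ℤ) : ℂ) = ((q 4 : ℤ) : ℂ) := by rw [f4]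
  -- rewrite the composite exponents / Gamma arguments (universally in `η`, so that `simp only` rewrites under the integral)
  have r1 : ∀ η : ℝ, ((q 2 : ℤ) : ℂ) - (m₆ : ℂ) - 1 - (-(c₂ : ℂ) + (η : ℂ) * Complex.I) =
      (l1 : ℂ) + (l2 : ℂ) - (((p 3 : ℤ) : ℂ) + 1 + (-(c₂ : ℂ) + (η : ℂ) * Complex.I)) := by
    intro η; linear_combination a5 + h18C
  have r2 : ∀ η : ℝ, ((p' 3 : ℤ) : ℂ) + 1 + (-(c₂' : ℂ) + (η : ℂ) * Complex.I) =
      ((p 3 : ℤ) : ℂ) + 1 + (-(c₂ : ℂ) + (η : ℂ) * Complex.I) := by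
    intro η; linear_combination e3C - h18C - hc'C
  have r3 : ∀ η : ℝ, ((q' 2 : ℤ) : ℂ) - (n : ℂ) - 1 - (-(c₂' : ℂ) + (η : ℂ) * Complex.I) =
      (k1 : ℂ) + (l1 : ℂ) - (((p 3 : ℤ) : ℂ) + 1 + (-(c₂ : ℂ) + (η : ℂ) * Complex.I)) := by
    intro η; linear_combination b4 + h19C + hc'C
  have r4 : ∀ η : ℝ, ((p' 5 : ℤ) : ℂ) + 1 + (-(c₂' : ℂ) + (η : ℂ) * Complex.I) =
      ((p 5 : ℤ) : ℂ) + 1 + (-(c₂ : ℂ) + (η : ℂ) * Complex.I) := by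
    intro η; linear_combination e5C - hc'C
  have r5 : ∀ η : ℝ, ((p' 5 : ℤ) : ℂ) + ((q' 4 : ℤ) : ℂ) + 2 + (-(c₂' : ℂ) + (η : ℂ) * Complex.I) =
      ((p 5 : ℤ) : ℂ) + ((q 4 : ℤ) : ℂ) + 2 + (-(c₂ : ℂ) + (η : ℂ) * Complex.I) := by
    intro η; linear_combination e5C + b6 - hc'C
  have r6 : ∀ η : ℝ, ((p' 4 : ℤ) : ℂ) + 1 + (-(c₂' : ℂ) + (η : ℂ) * Complex.I) =
      ((p 4 : ℤ) : ℂ) + 1 + (-(c₂ : ℂ) + (η : ℂ) * Complex.I) := by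
    intro η; linear_combination e4C - hc'C
  have r7 : ∀ η : ℝ, ((p' 4 : ℤ) : ℂ) + ((q' 3 : ℤ) : ℂ) + 2 + (-(c₂' : ℂ) + (η : ℂ) * Complex.I) =
      ((p 4 : ℤ) : ℂ) + ((q 3 : ℤ) : ℂ) + 2 + (-(c₂ : ℂ) + (η : ℂ) * Complex.I) := by
    intro η; linear_combination e4C + b5 - hc'C
  have r8 : ∀ η : ℝ, (n : ℂ) + 1 + (-(c₂' : ℂ) + (η : ℂ) * Complex.I) =
      (m₆ : ℂ) + 1 + (-(c₂ : ℂ) + (η : ℂ) * Complex.I) := by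
    intro η; linear_combination -hc'C
  have r9 : ∀ η : ℝ, -(-(c₂' : ℂ) + (η : ℂ) * Complex.I) =
      ((n : ℂ) - (m₆ : ℂ)) - (-(c₂ : ℂ) + (η : ℂ) * Complex.I) := by
    intro η; linear_combination hc'C
  simp only [r1, a1, a2, a3, a4] at hJ
  simp only [r2, r3, r4, r5, r6, r7, r8, r9] at hJ'
  simp only [b0, b1, b2, b3, b5, b6, e2C] at hJ'
  -- the pointwise identity of the two integrands
  have key : ∀ η : ℝ,
      ((((k2 + l2 - k1)! * m₆ ! : ℕ) : ℝ) : ℂ) *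
        ((Complex.Gamma (((p 5 : ℤ) : ℂ) + 1 + (-(c₂ : ℂ) + (η : ℂ) * Complex.I)) * Complex.Gamma (((q 4 : ℤ) : ℂ) + 1) /
            Complex.Gamma (((p 5 : ℤ) : ℂ) + ((q 4 : ℤ) : ℂ) + 2 + (-(c₂ : ℂ) + (η : ℂ) * Complex.I))) *
        ((Complex.Gamma (((p 4 : ℤ) : ℂ) + 1 + (-(c₂ : ℂ) + (η : ℂ) * Complex.I)) * Complex.Gamma (((q 3 : ℤ) : ℂ) + 1) /
            Complex.Gamma (((p 4 : ℤ) : ℂ) + ((q 3 : ℤ) : ℂ) + 2 + (-(c₂ : ℂ) + (η : ℂ) * Complex.I))) *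
        ∫ x in (univ.pi fun _ : Fin 3 => Ioo (0:ℝ) 1),
          ((x 0 : ℝ) : ℂ) ^ ((k1 : ℂ)) * ((1 - x 0 : ℝ) : ℂ) ^ ((l1 : ℂ)) * ((x 1 : ℝ) : ℂ) ^ ((k2 : ℂ)) *
            ((1 - x 1 : ℝ) : ℂ) ^ ((l2 : ℂ)) * ((x 2 : ℝ) : ℂ) ^ (((p 3 : ℤ) : ℂ) + 1 + (-(c₂ : ℂ) + (η : ℂ) * Complex.I)) *
            ((1 - x 2 : ℝ) : ℂ) ^ ((l1 : ℂ) + (l2 : ℂ) - (((p 3 : ℤ) : ℂ) + 1 + (-(c₂ : ℂ) + (η : ℂ) * Complex.I))) /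
            ((1 - (1 - x 0 * x 1) * x 2 : ℝ) : ℂ) ^ (((p 0 : ℤ) : ℂ) + 1)) *
        (Complex.Gamma ((m₆ : ℂ) + 1 + (-(c₂ : ℂ) + (η : ℂ) * Complex.I)) *
            Complex.Gamma (-(-(c₂ : ℂ) + (η : ℂ) * Complex.I)) / (m₆.factorial : ℂ))) =
      ((((k2 ! * n ! : ℕ) : ℝ)) : ℂ) *
        ((Complex.Gamma (((p 5 : ℤ) : ℂ) + 1 + (-(c₂ : ℂ) + (η : ℂ) * Complex.I)) * Complex.Gamma (((q 4 : ℤ) : ℂ) + 1) /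
            Complex.Gamma (((p 5 : ℤ) : ℂ) + ((q 4 : ℤ) : ℂ) + 2 + (-(c₂ : ℂ) + (η : ℂ) * Complex.I))) *
        ((Complex.Gamma (((p 4 : ℤ) : ℂ) + 1 + (-(c₂ : ℂ) + (η : ℂ) * Complex.I)) * Complex.Gamma (((q 3 : ℤ) : ℂ) + 1) /
            Complex.Gamma (((p 4 : ℤ) : ℂ) + ((q 3 : ℤ) : ℂ) + 2 + (-(c₂ : ℂ) + (η : ℂ) * Complex.I))) *
        ∫ x in (univ.pi fun _ : Fin 3 => Ioo (0:ℝ) 1),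
          ((x 0 : ℝ) : ℂ) ^ ((l2 : ℂ)) * ((1 - x 0 : ℝ) : ℂ) ^ ((l1 : ℂ)) * ((x 1 : ℝ) : ℂ) ^ ((k2 : ℂ) + (l2 : ℂ) - (k1 : ℂ)) *
            ((1 - x 1 : ℝ) : ℂ) ^ ((k1 : ℂ)) * ((x 2 : ℝ) : ℂ) ^ (((p 3 : ℤ) : ℂ) + 1 + (-(c₂ : ℂ) + (η : ℂ) * Complex.I)) *
            ((1 - x 2 : ℝ) : ℂ) ^ ((k1 : ℂ) + (l1 : ℂ) - (((p 3 : ℤ) : ℂ) + 1 + (-(c₂ : ℂ) + (η : ℂ) * Complex.I))) /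
            ((1 - (1 - x 0 * x 1) * x 2 : ℝ) : ℂ) ^ (((p 0 : ℤ) : ℂ) + 1)) *
        (Complex.Gamma ((m₆ : ℂ) + 1 + (-(c₂ : ℂ) + (η : ℂ) * Complex.I)) *
            Complex.Gamma (((n : ℂ) - (m₆ : ℂ)) - (-(c₂ : ℂ) + (η : ℂ) * Complex.I)) / (n.factorial : ℂ))) := by
    intro η
    set t : ℂ := -(c₂ : ℂ) + (η : ℂ) * Complex.I with ht_def
    have ht : t.re = -c₂ := by simp [ht_def]
    have hw := rv_conj_hprime (p 0) k1 l1 k2 l2 hk (((p 3 : ℤ) : ℂ) + 1 + t) (by simp [ht]; linarith)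
      (by simp [ht]; linarith [h18R, h19R, hl1R, hl2R, hmR, hnR, hk1R, hc0', hc'])
      (by simp [ht]; linarith [h19R, hk1R, hl1R]) (by simp [ht]; linarith [h19R, hk1R, hl1R, hl2R])
      (by simp [ht]; linarith [h19R, hk1R, hl1R, hl2R, hk2R])
    rw [show (k1 : ℂ) + l1 - (((p 3 : ℤ) : ℂ) + 1 + t) + 1 = -t by linear_combination -h19C,
      show (l1 : ℂ) + l2 - (((p 3 : ℤ) : ℂ) + 1 + t) + 1 = ((n : ℂ) - (m₆ : ℂ)) - t by linear_combination -h18C,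
      show (k2 : ℂ) + l2 - k1 + 1 = ((k2 + l2 - k1 : ℕ) : ℂ) + 1 by push_cast [hk]; ring,
      Complex.Gamma_nat_eq_factorial, Complex.Gamma_nat_eq_factorial] at hw
    generalize (∫ x in (univ.pi fun _ : Fin 3 => Ioo (0:ℝ) 1),
          ((x 0 : ℝ) : ℂ) ^ ((k1 : ℂ)) * ((1 - x 0 : ℝ) : ℂ) ^ ((l1 : ℂ)) * ((x 1 : ℝ) : ℂ) ^ ((k2 : ℂ)) *
            ((1 - x 1 : ℝ) : ℂ) ^ ((l2 : ℂ)) * ((x 2 : ℝ) : ℂ) ^ (((p 3 : ℤ) : ℂ) + 1 + t) *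
            ((1 - x 2 : ℝ) : ℂ) ^ ((l1 : ℂ) + (l2 : ℂ) - (((p 3 : ℤ) : ℂ) + 1 + t)) /
            ((1 - (1 - x 0 * x 1) * x 2 : ℝ) : ℂ) ^ (((p 0 : ℤ) : ℂ) + 1)) = T0 at hw ⊢
    generalize (∫ x in (univ.pi fun _ : Fin 3 => Ioo (0:ℝ) 1),
          ((x 0 : ℝ) : ℂ) ^ ((l2 : ℂ)) * ((1 - x 0 : ℝ) : ℂ) ^ ((l1 : ℂ)) * ((x 1 : ℝ) : ℂ) ^ ((k2 : ℂ) + (l2 : ℂ) - (k1 : ℂ)) *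
            ((1 - x 1 : ℝ) : ℂ) ^ ((k1 : ℂ)) * ((x 2 : ℝ) : ℂ) ^ (((p 3 : ℤ) : ℂ) + 1 + t) *
            ((1 - x 2 : ℝ) : ℂ) ^ ((k1 : ℂ) + (l1 : ℂ) - (((p 3 : ℤ) : ℂ) + 1 + t)) /
            ((1 - (1 - x 0 * x 1) * x 2 : ℝ) : ℂ) ^ (((p 0 : ℤ) : ℂ) + 1)) = T6 at hw ⊢
    have hfac : ((m₆ ! : ℕ) : ℂ) ≠ 0 := by exact_mod_cast Nat.factorial_ne_zero _
    have hfac' : ((n ! : ℕ) : ℂ) ≠ 0 := by exact_mod_cast Nat.factorial_ne_zero _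
    have u1 : ((m₆ ! : ℕ) : ℂ) * ((m₆ ! : ℕ) : ℂ)⁻¹ = 1 := mul_inv_cancel₀ hfac
    have u2 : ((n ! : ℕ) : ℂ) * ((n ! : ℕ) : ℂ)⁻¹ = 1 := mul_inv_cancel₀ hfac'
    simp only [div_eq_mul_inv]
    push_cast
    linear_combination (Complex.Gamma (((p 5 : ℤ) : ℂ) + 1 + t) * Complex.Gamma (((q 4 : ℤ) : ℂ) + 1) *
        (Complex.Gamma (((p 5 : ℤ) : ℂ) + ((q 4 : ℤ) : ℂ) + 2 + t))⁻¹ * (Complex.Gamma (((p 4 : ℤ) : ℂ) + 1 + t) *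
        Complex.Gamma (((q 3 : ℤ) : ℂ) + 1) * (Complex.Gamma (((p 4 : ℤ) : ℂ) + ((q 3 : ℤ) : ℂ) + 2 + t))⁻¹) *
        Complex.Gamma ((m₆ : ℂ) + 1 + t)) * hw
      + (Complex.Gamma (((p 5 : ℤ) : ℂ) + 1 + t) * Complex.Gamma (((q 4 : ℤ) : ℂ) + 1) *
        (Complex.Gamma (((p 5 : ℤ) : ℂ) + ((q 4 : ℤ) : ℂ) + 2 + t))⁻¹ * (Complex.Gamma (((p 4 : ℤ) : ℂ) + 1 + t) *
        Complex.Gamma (((q 3 : ℤ) : ℂ) + 1) * (Complex.Gamma (((p 4 : ℤ) : ℂ) + ((q 3 : ℤ) : ℂ) + 2 + t))⁻¹) *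
        Complex.Gamma ((m₆ : ℂ) + 1 + t) * ((((k2 + l2 - k1)! : ℕ) : ℂ) * Complex.Gamma (-t) * T0)) * u1
      - (Complex.Gamma (((p 5 : ℤ) : ℂ) + 1 + t) * Complex.Gamma (((q 4 : ℤ) : ℂ) + 1) *
        (Complex.Gamma (((p 5 : ℤ) : ℂ) + ((q 4 : ℤ) : ℂ) + 2 + t))⁻¹ * (Complex.Gamma (((p 4 : ℤ) : ℂ) + 1 + t) *
        Complex.Gamma (((q 3 : ℤ) : ℂ) + 1) * (Complex.Gamma (((p 4 : ℤ) : ℂ) + ((q 3 : ℤ) : ℂ) + 2 + t))⁻¹) *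
        Complex.Gamma ((m₆ : ℂ) + 1 + t) * (((k2 ! : ℕ) : ℂ) * Complex.Gamma ((n : ℂ) - (m₆ : ℂ) - t) * T6)) * u2
  -- integrate
  have hC : ((((k2 + l2 - k1)! * m₆ ! : ℕ) : ℝ) : ℂ) * (Jintegral p q : ℂ) =
      ((((k2 ! * n ! : ℕ) : ℝ)) : ℂ) * (Jintegral p' q' : ℂ) := by
    rw [hJ, hJ', mul_left_comm ((((k2 + l2 - k1)! * m₆ ! : ℕ) : ℝ) : ℂ), mul_left_comm ((((k2 ! * n ! : ℕ) : ℝ)) : ℂ),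
      ← integral_const_mul ((((k2 + l2 - k1)! * m₆ ! : ℕ) : ℝ) : ℂ), ← integral_const_mul ((((k2 ! * n ! : ℕ) : ℝ)) : ℂ)]
    congr 1
    exact integral_congr_ae (Eventually.of_forall key)
  exact_mod_cast hC

/-! ### 2. (27) for `h'` -/

/-- Bookkeeping of `∏_{i∈F} h_i!` under `h'`: the multiset `{h_i(h'a)}_{i∈F}` is `{h_i(a)}_{i∈F}` with `p₂, q₃` replaced by
`p₂+q₂−p₁, p₆`. [BrownZudilin2022, Sect. 7, (26)–(27)] -/
theorem normF_genH' (a : Fin 8 → ℤ) :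
    ((Fset.map fun i => ((hForm (genH' a) i).toNat.factorial : ℝ)).prod) *
        (((pOf a 2).toNat.factorial * (qOf a 2).toNat.factorial : ℕ) : ℝ) =
      ((Fset.map fun i => ((hForm a i).toNat.factorial : ℝ)).prod) *
        ((((pOf a 2 + qOf a 1 - pOf a 1).toNat.factorial * (pOf a 6).toNat.factorial : ℕ)) : ℝ) := by
  simp [Fset, hForm, hList, genH', pOf, qOf]
  ring_nf

/-- **`I` under `h'`** (letters of `a`): `I(h'a)·p₂!·q₃! = I(a)·(p₂+q₂−p₁)!·p₆!`, for EVERY pair `a`, `h'a` of convergent exponents.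
[BrownZudilin2022, Sect. 7, p. 18 (`J(p;q)/(p₂!q₃!)` is `h'`-invariant)] -/
theorem cellularIntegral_genH' {a : Fin 8 → ℤ} (ha : Converges a) (hga : Converges (genH' a)) :
    cellularIntegral (genH' a) * (((pOf a 2).toNat.factorial * (qOf a 2).toNat.factorial : ℕ) : ℝ) =
      cellularIntegral a * ((((pOf a 2 + qOf a 1 - pOf a 1).toNat.factorial * (pOf a 6).toNat.factorial : ℕ)) : ℝ) := by
  have hA := ha
  have hB := hga
  simp only [Converges, convergenceForms, genH', List.mem_cons, List.not_mem_nil, or_false, forall_eq_or_imp, forall_eq,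
    Matrix.cons_val_zero, Matrix.cons_val_one, Matrix.cons_val] at hA hB
  obtain ⟨g0, g1, g2, g3, g4, g5, g6, g7, g8, g9, g10, g11, g12, g13, g14, g15, g16⟩ := hA
  obtain ⟨g0', g1', g2', g3', g4', g5', g6', g7', g8', g9', g10', g11', g12', g13', g14', g15', g16'⟩ := hB
  -- the naturals
  obtain ⟨k1, hk1⟩ := Int.eq_ofNat_of_zero_le (show 0 ≤ pOf a 1 by simp [pOf]; omega)
  obtain ⟨l1, hl1⟩ := Int.eq_ofNat_of_zero_le (show 0 ≤ qOf a 0 by simp [qOf]; omega)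
  obtain ⟨k2, hk2⟩ := Int.eq_ofNat_of_zero_le (show 0 ≤ pOf a 2 by simp [pOf]; omega)
  obtain ⟨l2, hl2⟩ := Int.eq_ofNat_of_zero_le (show 0 ≤ qOf a 1 by simp [qOf]; omega)
  obtain ⟨m₆, hm⟩ := Int.eq_ofNat_of_zero_le (show 0 ≤ pOf a 6 by simp [pOf]; omega)
  obtain ⟨n, hn⟩ := Int.eq_ofNat_of_zero_le (show 0 ≤ qOf a 2 by simp [qOf]; omega)
  have hk : k1 ≤ k2 + l2 := by
    have : pOf a 1 ≤ pOf a 2 + qOf a 1 := by simp [pOf, qOf]; omega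
    rw [hk1, hk2, hl2] at this; exact_mod_cast this
  -- the abscissa
  have i1 : pOf a 6 - qOf a 2 < pOf a 4 + 1 := by simp [pOf, qOf]; omega
  have i2 : pOf a 6 - qOf a 2 < pOf a 5 + 1 := by simp [pOf, qOf]; omega
  have i3 : pOf a 6 - qOf a 2 < pOf a 3 + 2 := by simp [pOf, qOf]; omega
  have i4 : pOf a 0 - qOf a 1 < pOf a 6 + 1 := by simp [pOf, qOf]; omega
  have i5 : pOf a 0 - qOf a 1 < pOf a 4 + 1 := by simp [pOf, qOf]; omega
  have i6 : pOf a 0 - qOf a 1 < pOf a 5 + 1 := by simp [pOf, qOf]; omega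
  have i7 : pOf a 0 - qOf a 1 < pOf a 3 + 2 := by simp [pOf, qOf]; omega
  have i8 : pOf a 0 + pOf a 1 - pOf a 2 - qOf a 1 < pOf a 6 + 1 := by simp [pOf, qOf]; omega
  have i9 : pOf a 0 + pOf a 1 - pOf a 2 - qOf a 1 < pOf a 4 + 1 := by simp [pOf, qOf]; omega
  have i10 : pOf a 0 + pOf a 1 - pOf a 2 - qOf a 1 < pOf a 5 + 1 := by simp [pOf, qOf]; omega
  have i11 : pOf a 0 + pOf a 1 - pOf a 2 - qOf a 1 < pOf a 3 + 2 := by simp [pOf, qOf]; omega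
  have i12 : 0 < pOf a 4 + 1 := by simp [pOf]; omega
  have i13 : 0 < pOf a 5 + 1 := by simp [pOf]; omega
  have i14 : 0 < pOf a 3 + 2 := by simp [pOf]; omega
  have i15 : 0 ≤ qOf a 2 := by simp [qOf]; omega
  have I1 : ((pOf a 6 : ℤ) : ℝ) - qOf a 2 < pOf a 4 + 1 := by exact_mod_cast i1
  have I2 : ((pOf a 6 : ℤ) : ℝ) - qOf a 2 < pOf a 5 + 1 := by exact_mod_cast i2
  have I3 : ((pOf a 6 : ℤ) : ℝ) - qOf a 2 < pOf a 3 + 2 := by exact_mod_cast i3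
  have I4 : ((pOf a 0 : ℤ) : ℝ) - qOf a 1 < pOf a 6 + 1 := by exact_mod_cast i4
  have I5 : ((pOf a 0 : ℤ) : ℝ) - qOf a 1 < pOf a 4 + 1 := by exact_mod_cast i5
  have I6 : ((pOf a 0 : ℤ) : ℝ) - qOf a 1 < pOf a 5 + 1 := by exact_mod_cast i6
  have I7 : ((pOf a 0 : ℤ) : ℝ) - qOf a 1 < pOf a 3 + 2 := by exact_mod_cast i7
  have I8 : ((pOf a 0 : ℤ) : ℝ) + pOf a 1 - pOf a 2 - qOf a 1 < pOf a 6 + 1 := by exact_mod_cast i8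
  have I9 : ((pOf a 0 : ℤ) : ℝ) + pOf a 1 - pOf a 2 - qOf a 1 < pOf a 4 + 1 := by exact_mod_cast i9
  have I10 : ((pOf a 0 : ℤ) : ℝ) + pOf a 1 - pOf a 2 - qOf a 1 < pOf a 5 + 1 := by exact_mod_cast i10
  have I11 : ((pOf a 0 : ℤ) : ℝ) + pOf a 1 - pOf a 2 - qOf a 1 < pOf a 3 + 2 := by exact_mod_cast i11
  have I12 : (0 : ℝ) < pOf a 4 + 1 := by exact_mod_cast i12
  have I13 : (0 : ℝ) < pOf a 5 + 1 := by exact_mod_cast i13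
  have I14 : (0 : ℝ) < pOf a 3 + 2 := by exact_mod_cast i14
  have I15 : (0 : ℝ) ≤ qOf a 2 := by exact_mod_cast i15
  have hmR : ((pOf a 6 : ℤ) : ℝ) = m₆ := by rw [hm]; rfl
  have hnR : ((qOf a 2 : ℤ) : ℝ) = n := by rw [hn]; rfl
  have hk1R : ((pOf a 1 : ℤ) : ℝ) = k1 := by rw [hk1]; rfl
  have hk2R : ((pOf a 2 : ℤ) : ℝ) = k2 := by rw [hk2]; rfl
  have hl2R : ((qOf a 1 : ℤ) : ℝ) = l2 := by rw [hl2]; rfl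
  have hm0 : (0 : ℝ) ≤ m₆ := m₆.cast_nonneg
  have I16 : (0 : ℝ) < pOf a 6 + 1 := by rw [hmR]; linarith
  have I17 : ((pOf a 6 : ℤ) : ℝ) - qOf a 2 < pOf a 6 + 1 := by linarith
  obtain ⟨c₂, hlo, hhi⟩ := exists_between (show max (max (0 : ℝ) ((pOf a 6 : ℝ) - qOf a 2))
      (max ((pOf a 0 : ℝ) - qOf a 1) ((pOf a 0 : ℝ) + pOf a 1 - pOf a 2 - qOf a 1)) <
      min (min ((pOf a 6 : ℝ) + 1) ((pOf a 4 : ℝ) + 1)) (min ((pOf a 5 : ℝ) + 1) ((pOf a 3 : ℝ) + 2)) from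
    max_lt (max_lt (lt_min (lt_min I16 I12) (lt_min I13 I14)) (lt_min (lt_min I17 I1) (lt_min I2 I3)))
      (max_lt (lt_min (lt_min I4 I5) (lt_min I6 I7)) (lt_min (lt_min I8 I9) (lt_min I10 I11))))
  simp only [max_lt_iff, lt_min_iff] at hlo hhi
  obtain ⟨⟨hc0, hcr⟩, hcA, hcB⟩ := hlo
  obtain ⟨⟨hc6, hc4⟩, hc5, hc3⟩ := hhi
  -- the identity for `J`
  have hJ := Jintegral_hprime (pOf a) (pOf (genH' a)) (qOf a) (qOf (genH' a)) hk1 hl1 hk2 hl2 hm hn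
    (by simp only [qOf, Matrix.cons_val]; omega) (by simp only [qOf, Matrix.cons_val]; omega)
    (by simp only [pOf, qOf, Matrix.cons_val_zero, Matrix.cons_val_one, Matrix.cons_val]; omega)
    (by simp only [pOf, qOf, Matrix.cons_val_zero, Matrix.cons_val_one, Matrix.cons_val]; omega) hk
    (by simp only [pOf, genH', Matrix.cons_val_zero, Matrix.cons_val_one, Matrix.cons_val]; omega)
    (by simp only [pOf, qOf, genH', Matrix.cons_val_zero, Matrix.cons_val_one, Matrix.cons_val]; omega)
    (by simp only [pOf, qOf, genH', Matrix.cons_val_zero, Matrix.cons_val_one, Matrix.cons_val]; omega)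
    (by simp only [pOf, qOf, genH', Matrix.cons_val_zero, Matrix.cons_val_one, Matrix.cons_val]; omega)
    (by simp only [pOf, qOf, genH', Matrix.cons_val_zero, Matrix.cons_val_one, Matrix.cons_val]; omega)
    (by simp only [pOf, qOf, genH', Matrix.cons_val_zero, Matrix.cons_val_one, Matrix.cons_val]; omega)
    (by simp only [pOf, qOf, genH', Matrix.cons_val_zero, Matrix.cons_val_one, Matrix.cons_val]; omega)
    (by simp only [qOf, genH', Matrix.cons_val_zero, Matrix.cons_val_one, Matrix.cons_val])
    (by simp only [pOf, qOf, genH', Matrix.cons_val_zero, Matrix.cons_val_one, Matrix.cons_val]; omega)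
    (by simp only [pOf, qOf, genH', Matrix.cons_val_zero, Matrix.cons_val_one, Matrix.cons_val]; omega)
    (by simp only [qOf, genH', Matrix.cons_val_zero, Matrix.cons_val_one, Matrix.cons_val])
    (by simp only [qOf, genH', Matrix.cons_val_zero, Matrix.cons_val_one, Matrix.cons_val])
    (c₂ := c₂) (c₂' := c₂ + ((n : ℝ) - m₆)) (by ring) hc0
    (by rw [hmR, hnR] at hcr; linarith) (by rw [hmR] at hc6; linarith) hc4 hc5 hc3
    (by rw [hl2R] at hcA; linarith) (by rw [hk1R, hk2R, hl2R] at hcB; linarith)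
  rw [cellularIntegral_eq_Jintegral, cellularIntegral_eq_Jintegral]
  have t1 : (pOf a 2).toNat = k2 := by rw [hk2]; rfl
  have t2 : (qOf a 2).toNat = n := by rw [hn]; rfl
  have t3 : (pOf a 2 + qOf a 1 - pOf a 1).toNat = k2 + l2 - k1 := by rw [hk2, hl2, hk1]; omega
  have t4 : (pOf a 6).toNat = m₆ := by rw [hm]; rfl
  rw [t1, t2, t3, t4]
  linear_combination -hJ

/-- **(27) under `h'` — the `h'`-conjunct of the named Literature fact `invariance_of_converges'`, WITHOUT Bailey's
transformation and for EVERY pair `a`, `h'a` of convergent exponents**: `I(h'a)/∏_{i∈F} h_i(h'a)! = I(a)/∏_{i∈F} h_i(a)!`.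
[BrownZudilin2022, Sect. 7, eq. (27) (generator `h'`); RV §§2, 4] -/
theorem normalisedIntegral'_genH' {a : Fin 8 → ℤ} (ha : Converges a) (hga : Converges (genH' a)) :
    normalisedIntegral' (genH' a) = normalisedIntegral' a := by
  have hI := cellularIntegral_genH' ha hga
  have hP := normF_genH' a
  have hc : (((pOf a 2).toNat.factorial * (qOf a 2).toNat.factorial : ℕ) : ℝ) ≠ 0 := by positivity
  unfold normalisedIntegral'
  rw [div_eq_div_iff (normF_pos _).ne' (normF_pos _).ne']
  refine mul_right_cancel₀ hc ?_
  linear_combination ((Fset.map fun i => ((hForm a i).toNat.factorial : ℝ)).prod) * hI - cellularIntegral a * hP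

end Summit.KontsevichZagierPeriods.Zeta5Search.JintegralHprime

end
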